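import Literature.NumberTheory.GaloisRepresentations.LubinTateColemanInterpolation
import Literature.NumberTheory.GaloisRepresentations.LubinTateTowerRelNorm
import HarnessLib

/-!
# Coleman's interpolation theorem for norm-coherent sequences in the `Algebra.norm` currency

De Shalit, *Iwasawa theory of elliptic curves with complex multiplication* (1987), Ch. I §2.2 Theorem,
with the norm-coherence hypothesis `N_{m,n}(β_m) = β_n` stated through Mathlib's `Algebra.norm` for the
tower algebra `K_π^{n+1} → K_π^{m+1}` (`towerAlgebra`, `LubinTateTowerRelNorm.lean`) instead of the
stabiliser products of `LubinTateColemanInterpolation.lean`. Everything **proved** (`f = πX + X^q` over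
any non-archimedean local field `F`, absolute case):

* ★ `exists_evalAt_cohPt_eq_of_towerNorm` — if `β_m ∈ 𝒪_{K_π^{m+1}}ˣ` and
  `N_{K_π^{m+1}/K_π^{n+1}}(β_m) = β_n` for all `n ≤ m`, there is `g ∈ 𝒪_F⟦X⟧` with `𝒩 g = g` and
  `g(ω_{m+1}) = β_m` for all `m` (unique by `eq_of_forall_evalAt_cohPt_eq`).
* `towerNorm_evalAt_cohPt_eq` — conversely, for `𝒩 g = g` the values `(g(ω_{m+1}))_m` satisfy
  `N_{K_π^{m+1}/K_π^{n+1}}(g(ω_{m+1})) = g(ω_{n+1})` (Cor. 2.3 (ii) read backwards).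
* The constant term: `norm_evalAt_sub_constantCoeff_le` (`‖g(x) - g(0)‖ ≤ ‖x‖`), hence
  `isUnit_constantCoeff_of_norm_evalAt_eq_one` (**`g_β ∈ 𝒪_F⟦X⟧ˣ`** when the `β_m` are units) and
  `dvd_constantCoeff_sub_one_of_norm_evalAt_sub_one_lt` (**`g_β ≡ 1 (mod (π, X))`** for principal units).

Together: **`𝒰 = lim← U(K_π^{m+1})` (norm-coherent principal units of the Lubin–Tate tower) corresponds
bijectively to the principal `𝒩`-invariant series `ℳ_f`** — the object of de Shalit I §3.

## References

* E. de Shalit, *Iwasawa theory of elliptic curves with complex multiplication* (1987), Ch. I §2.2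
  Theorem, Cor. 2.3 (ii). [cite: deShalit1987, Ch. I §2.2 Theorem]
* R. Coleman, *Division values in local fields*, Invent. Math. 53 (1979), Thm. A.

## Mathlib reuse

`Algebra.norm`; from the tree: `LubinTateColemanInterpolation.lean` (`exists_evalAt_cohPt_eq`),
`LubinTateTowerRelNorm.lean` (`towerAlgebra`, `algebraMap_towerNorm_ltField_eq_prod_stabilizer`),
`LubinTateColemanNormCoherent.lean` (`prod_stabilizer_algEquiv_evalAt_of_colemanNorm_eq`),
`LubinTateColemanLevel.lean` (`colemanNorm_level_eq`), `LubinTateTowerGenerator.lean` (`cohPt`,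
`ltAct_pow_sub_cohPt`, `inclUnitBall_evalAt`), `LubinTateCharacterLimit.lean` (`coe_inclUnitBall`).
-/

noncomputable section

open Filter Topology Polynomial ValuativeRel
open scoped PowerSeries.WithPiTopology

namespace Literature.NumberTheory.GaloisRepresentations

section LocalFieldIN

open GaloisRepresentations.IsNonarchimedeanLocalField LubinTate

variable (F : Type*) [Field F] [ValuativeRel F] [TopologicalSpace F] [IsNonarchimedeanLocalField F]

attribute [local instance] ltNormUniformSpace ltNormIsUniformAddGroup rk1 nF nE fintypeResidueField

variable {F}
variable {π : 𝒪[F]} (hπ : (valuation F).IsUniformizer (π : F))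

/-- ★ **Coleman's interpolation theorem with `Algebra.norm`-coherence** (de Shalit I §2.2 Theorem): for
units `β_m ∈ 𝒪_{K_π^{m+1}}` with `N_{K_π^{m+1}/K_π^{n+1}}(β_m) = β_n` (`n ≤ m`, the norm of the tower algebra),
there is `g ∈ 𝒪_F⟦X⟧` with `𝒩 g = g` and `g(ω_{m+1}) = β_m` for all `m`.
[cite: deShalit1987, Ch. I §2.2 Theorem] -/
theorem exists_evalAt_cohPt_eq_of_towerNorm (β : ∀ m : ℕ, unitBall (ltField π m))
    (hβ : ∀ m, ‖((β m : unitBall (ltField π m)) : ltField π m)‖ = 1)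
    (hcoh : ∀ n m (hnm : n ≤ m),
      @Algebra.norm (ltField π n) (ltField π m) _ _ (towerAlgebra (ltField_mono hπ hnm))
        ((β m : unitBall (ltField π m)) : ltField π m) = ((β n : unitBall (ltField π n)) : ltField π n)) :
    ∃ g : PowerSeries (LTCoeff F), colemanNorm hπ 0 g = g ∧
      ∀ m, evalAt (maxNilIdeal F (ltField π m)) (cohPt hπ m) g = β m := by
  refine exists_evalAt_cohPt_eq hπ β hβ fun n m hnm => ?_
  rw [← algebraMap_towerNorm_ltField_eq_prod_stabilizer hπ hnm, hcoh n m hnm, coe_inclUnitBall]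

/-- **Norm-coherence of the values of an `𝒩`-invariant series, in the `Algebra.norm` currency**
(de Shalit Cor. 2.3 (ii) read backwards): if `𝒩 g = g` then
`N_{K_π^{m+1}/K_π^{n+1}}(g(ω_{m+1})) = g(ω_{n+1})` for `n ≤ m`.
[cite: deShalit1987, Ch. I §2.3 (ii)] -/
theorem towerNorm_evalAt_cohPt_eq {g : PowerSeries (LTCoeff F)} (hg : colemanNorm hπ 0 g = g) {n m : ℕ}
    (hnm : n ≤ m) :
    @Algebra.norm (ltField π n) (ltField π m) _ _ (towerAlgebra (ltField_mono hπ hnm))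
        ((evalAt (maxNilIdeal F (ltField π m)) (cohPt hπ m) g : unitBall (ltField π m)) : ltField π m) =
      ((evalAt (maxNilIdeal F (ltField π n)) (cohPt hπ n) g : unitBall (ltField π n)) : ltField π n) := by
  apply IntermediateField.inclusion_injective (ltField_mono hπ hnm)
  rw [algebraMap_towerNorm_ltField_eq_prod_stabilizer hπ hnm, ← ltAct_pow_sub_cohPt hπ hnm, cohPt_eq]
  have hg' : colemanNorm hπ m g = g := by rw [← colemanNorm_level_eq hπ 0 m]; exact hg
  rw [prod_stabilizer_algEquiv_evalAt_of_colemanNorm_eq hπ m (cohUnit hπ m) (by omega : m - n ≤ m) hg',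
    ← cohPt_eq, ltAct_pow_sub_cohPt hπ hnm, ← inclUnitBall_evalAt, coe_inclUnitBall]

/-! ### The constant term of the interpolating series -/

include hπ in
/-- **`g(x) ≡ g(0) (mod 𝔪_E)`**: `‖g(x) - g(0)‖ ≤ ‖x‖` for `g ∈ 𝒪_F⟦X⟧` and a point `x ∈ 𝔪_E`.
[cite: deShalit1987, Ch. I §3.3] -/
theorem norm_evalAt_sub_constantCoeff_le {E : IntermediateField F (AlgebraicClosure F)} [FiniteDimensional F E]
    (g : PowerSeries (LTCoeff F)) (x : (maxNilIdeal F E).toIdeal) :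
    ‖((evalAt (maxNilIdeal F E) x g : unitBall E) : E) -
        ((algebraMap (LTCoeff F) (unitBall E) (PowerSeries.constantCoeff g) : unitBall E) : E)‖ ≤
      ‖((x : unitBall E) : E)‖ := by
  -- compare `g` with the constant series `C g₀`: they agree in degree `0` modulo every `π^a`
  have key : ∀ a : ℕ, ‖((evalAt (maxNilIdeal F E) x g : unitBall E) : E) -
      ((evalAt (maxNilIdeal F E) x (PowerSeries.C (PowerSeries.constantCoeff g)) : unitBall E) : E)‖ ≤
      max (‖(π : F)‖ ^ a) (‖((x : unitBall E) : E)‖ ^ 1) := fun a =>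
    norm_evalAt_sub_le_of_forall_lt (π := π) (a := a) (K := 1) (fun k hk => by
      have hk0 : k = 0 := by omega
      subst hk0
      rw [PowerSeries.coeff_zero_eq_constantCoeff, PowerSeries.constantCoeff_C, sub_self]
      exact dvd_zero _) x
  have hC : ((evalAt (maxNilIdeal F E) x (PowerSeries.C (PowerSeries.constantCoeff g)) : unitBall E) : E) =
      ((algebraMap (LTCoeff F) (unitBall E) (PowerSeries.constantCoeff g) : unitBall E) : E) := by
    rw [PowerSeries.C_eq_algebraMap, AlgHom.commutes]
  rw [← hC]
  by_cases hx0 : ‖((x : unitBall E) : E)‖ = 0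
  · have hx0' : x = 0 := Subtype.ext (Subtype.ext (norm_eq_zero.mp hx0))
    subst hx0'
    rw [evalAt_zero, evalAt_zero, PowerSeries.constantCoeff_C, sub_self, norm_zero]
    exact norm_nonneg _
  · have hπlt : ‖(π : F)‖ < 1 := Valued.toNormedField.norm_lt_one_iff.mpr hπ.val_lt_one
    obtain ⟨a, ha⟩ := exists_pow_lt_of_lt_one (lt_of_le_of_ne (norm_nonneg _) (Ne.symm hx0)) hπlt
    refine le_trans (key a) (max_le ha.le ?_)
    rw [pow_one]

include hπ in
/-- **The constant term has the absolute value of any value**: `‖g(x)‖ = 1 ⟹ ‖g(0)‖ = 1` (`x ∈ 𝔪_E`).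
[cite: deShalit1987, Ch. I §2.2 Theorem] -/
theorem norm_constantCoeff_eq_one_of_norm_evalAt_eq_one {E : IntermediateField F (AlgebraicClosure F)}
    [FiniteDimensional F E] {g : PowerSeries (LTCoeff F)} {x : (maxNilIdeal F E).toIdeal}
    (h : ‖((evalAt (maxNilIdeal F E) x g : unitBall E) : E)‖ = 1) :
    ‖(((LTCoeff.of F).symm (PowerSeries.constantCoeff g) : 𝒪[F]) : F)‖ = 1 := by
  have hlt := lt_of_le_of_lt (norm_evalAt_sub_constantCoeff_le hπ g x) x.2
  rw [← norm_algebraMap_LTCoeff E, RingEquiv.apply_symm_apply]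
  set A := ((evalAt (maxNilIdeal F E) x g : unitBall E) : E)
  set B := ((algebraMap (LTCoeff F) (unitBall E) (PowerSeries.constantCoeff g) : unitBall E) : E)
  have hne : ‖A‖ ≠ ‖-(A - B)‖ := by rw [norm_neg, h]; exact (ne_of_lt hlt).symm
  have e : B = A + -(A - B) := by ring
  rw [e, IsUltrametricDist.norm_add_eq_max_of_norm_ne_norm hne, h, norm_neg]
  exact max_eq_left hlt.le

include hπ in
/-- **The interpolating series is a unit** when its value `g(x)` at some point is a unit: `‖g(x)‖ = 1 ⟹
g(0) ∈ 𝒪_Fˣ` (de Shalit: `g_β ∈ 𝒪'⟦X⟧ˣ`). [cite: deShalit1987, Ch. I §2.2 Theorem] -/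
theorem isUnit_constantCoeff_of_norm_evalAt_eq_one {E : IntermediateField F (AlgebraicClosure F)}
    [FiniteDimensional F E] {g : PowerSeries (LTCoeff F)} {x : (maxNilIdeal F E).toIdeal}
    (h : ‖((evalAt (maxNilIdeal F E) x g : unitBall E) : E)‖ = 1) :
    IsUnit (PowerSeries.constantCoeff g) := by
  have h1 := norm_constantCoeff_eq_one_of_norm_evalAt_eq_one hπ h
  have hv : valuation F (((LTCoeff.of F).symm (PowerSeries.constantCoeff g) : 𝒪[F]) : F) = 1 :=
    le_antisymm (Valued.toNormedField.norm_le_one_iff.mp h1.le) (Valued.toNormedField.one_le_norm_iff.mp h1.ge)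
  have hu : IsUnit ((LTCoeff.of F).symm (PowerSeries.constantCoeff g)) :=
    (Valuation.Integers.isUnit_iff_valuation_eq_one (Valuation.integer.integers (valuation F))).mpr hv
  simpa using hu.map (LTCoeff.of F)

include hπ in
/-- **Principal values give a principal series**: `‖g(x) - 1‖ < 1 ⟹ π ∣ g(0) - 1` (`g_β ≡ 1 mod (𝔭', T)` for
principal units `β`). [cite: deShalit1987, Ch. I §3.3] -/
theorem dvd_constantCoeff_sub_one_of_norm_evalAt_sub_one_lt {E : IntermediateField F (AlgebraicClosure F)}
    [FiniteDimensional F E] {g : PowerSeries (LTCoeff F)} {x : (maxNilIdeal F E).toIdeal}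
    (h : ‖((evalAt (maxNilIdeal F E) x g : unitBall E) : E) - 1‖ < 1) :
    LTCoeff.of F π ∣ PowerSeries.constantCoeff g - 1 := by
  have hlt := lt_of_le_of_lt (norm_evalAt_sub_constantCoeff_le hπ g x) x.2
  -- `‖g(0) - 1‖ < 1` in `E`, hence in `F`
  have h2 : ‖((algebraMap (LTCoeff F) (unitBall E) (PowerSeries.constantCoeff g - 1) : unitBall E) : E)‖ < 1 := by
    rw [map_sub, map_one, AddSubgroupClass.coe_sub, OneMemClass.coe_one]
    set A := ((evalAt (maxNilIdeal F E) x g : unitBall E) : E)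
    set B := ((algebraMap (LTCoeff F) (unitBall E) (PowerSeries.constantCoeff g) : unitBall E) : E)
    have e : B - 1 = (A - 1) + -(A - B) := by ring
    rw [e]
    refine lt_of_le_of_lt (IsUltrametricDist.norm_add_le_max _ _) (max_lt h ?_)
    rwa [norm_neg]
  have e2 : PowerSeries.constantCoeff g - 1 = LTCoeff.of F ((LTCoeff.of F).symm (PowerSeries.constantCoeff g - 1)) :=
    (RingEquiv.apply_symm_apply _ _).symm
  rw [e2, norm_algebraMap_LTCoeff] at h2
  obtain ⟨c, hc⟩ := dvd_of_norm_lt_one hπ h2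
  refine ⟨LTCoeff.of F c, ?_⟩
  rw [e2, hc, map_mul]

end LocalFieldIN

end Literature.NumberTheory.GaloisRepresentations
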